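import Summits.Ventures.PercRepro.S1CFCircuitCount
import Summits.Ventures.PercRepro.S1CFCover

/-!
# PercRepro — THE SMALL CAPS OF A LOOPLESS COLOOP-FREE MATROID OF NULLITY `4` ON `12` POINTS (p1, gen 37)

The first three N-side caps of p7's ν = 4 program (the contraction `N = M ／ W` of the case `ν = 4` of the cell `(13, 8)`):
for `N` loopless, coloop-free, `|E| = 12`, `|E| = rank + 4` (so `rank = 8`),
* **`ncard_closure_singleton_le_four`** — every parallel class `cl {x}` has at most `4` points (`cl {x} ⊊ E` has nullity
  `≤ 3` by S1CFNullity, and rank `1`);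
* **`ncard_four_eRk_le_one_le_one`** (`Q₄¹ ≤ 1`) — two distinct `4`-sets of rank `≤ 1` span a proper subset of nullity
  `≥ 4` (rank `≤ 1` on `≥ 5` points if they meet, rank `≤ 2` on `8` points if not);
* **`ncard_three_eRk_le_one_le_four`** (`Q₃¹ ≤ 4`) — all `3`-sets of rank `≤ 1` lie in ONE class (two in different classes
  span `6` points of rank `≤ 2`), so they number `≤ C(4, 3)`;
* **`ncard_dep_pairs_le_six`** (`D₂ ≤ 6`) — with `F = cl {x}` the class of a dependent pair (`f = |F| ∈ {2, 3, 4}`), the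
  pairs inside `F` number `≤ C(f, 2)` and the pairs outside `F` live in the set `U'` of points outside `F` with a partner,
  whose nullity is `≤ 4 − f` (`F ∪ U'` is a proper subset — `E` is not covered by parallel pairs, `2·8 > 12` — of nullity
  `≤ 3`, and `rk (F ∪ U') ≤ 1 + rk U'`); the relative circuit count gives `≤ C(5 − f, 2)`; `C(f, 2) + C(5 − f, 2) ≤ 6`.
All counts are of the form `{X : Set α | X ⊆ N.E ∧ X.ncard = k ∧ N.eRk X ≤ s}.ncard` / `N.Dep X`. Nothing about any cell
is claimed. Axioms: standard.
-/

open scoped Matroid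

namespace PercRepro

namespace S1CF

open Set

variable {α : Type}

/-- The `k`-subsets of a finite set `F` number `C(|F|, k)`. -/
theorem ncard_subsets_eq_choose {F : Set α} (hF : F.Finite) (k : ℕ) :
    {X : Set α | X ⊆ F ∧ X.ncard = k}.ncard = F.ncard.choose k := by
  classical
  have himg : {X : Set α | X ⊆ F ∧ X.ncard = k} =
      (fun s : Finset α => (s : Set α)) '' ((hF.toFinset.powersetCard k : Finset (Finset α)) : Set (Finset α)) := by
    ext X
    simp only [Set.mem_setOf_eq, Set.mem_image, Finset.mem_coe, Finset.mem_powersetCard]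
    constructor
    · rintro ⟨hXF, hXk⟩
      have hXfin : X.Finite := hF.subset hXF
      refine ⟨hXfin.toFinset, ⟨?_, ?_⟩, by simp⟩
      · intro x hx
        rw [Set.Finite.mem_toFinset] at hx ⊢
        exact hXF hx
      · rw [← hXk, Set.ncard_eq_toFinset_card X hXfin]
    · rintro ⟨s, ⟨hsF, hsk⟩, rfl⟩
      refine ⟨?_, by rw [Set.ncard_coe_finset, hsk]⟩
      intro x hx
      exact (Set.Finite.mem_toFinset hF).1 (hsF (Finset.mem_coe.1 hx))
  rw [himg, Set.ncard_image_of_injective _ Finset.coe_injective, Set.ncard_coe_finset,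
    Finset.card_powersetCard, Set.ncard_eq_toFinset_card F hF]

/-- The rank of the ground set is `8`. -/
theorem eRk_ground_toNat_eq_eight (M : Matroid α) [M.Finite] (hd : M.E.encard = M.eRank + ((4 : ℕ) : ℕ∞))
    (hn : M.E.ncard = 12) : (M.eRk M.E).toNat = 8 := by
  have := ncard_ground_eq_eRk_toNat_add M hd
  omega

/-- **Every subset of rank `≤ 7` has nullity `≤ 3`** (it is proper, and `E` is coloop-free). -/
theorem ncard_le_eRk_toNat_add_three (M : Matroid α) [M.Finite] (hK : ∀ e, ¬ M.IsColoop e)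
    (hd : M.E.encard = M.eRank + ((4 : ℕ) : ℕ∞)) (hn : M.E.ncard = 12) {X : Set α} (hX : X ⊆ M.E)
    (hr : (M.eRk X).toNat ≤ 7) : X.ncard ≤ (M.eRk X).toNat + 3 := by
  have h8 := eRk_ground_toNat_eq_eight M hd hn
  have hne : X ≠ M.E := by
    intro h; rw [h] at hr; omega
  have := ncard_add_one_le_eRk_toNat_add_of_ssubset M hd hK hX hne
  omega

/-- `rk X ≤ 1` (in `ℕ∞`) gives `rk X ≤ 1` in `ℕ`. -/
theorem eRk_toNat_le_of_eRk_le (M : Matroid α) [M.Finite] {X : Set α} (hX : X ⊆ M.E) {m : ℕ}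
    (h : M.eRk X ≤ m) : (M.eRk X).toNat ≤ m := by
  rw [← S1.coe_toNat_eRk M hX] at h
  exact_mod_cast h

/-- A parallel class has at most `4` points. -/
theorem ncard_closure_singleton_le_four (M : Matroid α) [M.Finite] (hK : ∀ e, ¬ M.IsColoop e)
    (hd : M.E.encard = M.eRank + ((4 : ℕ) : ℕ∞)) (hn : M.E.ncard = 12) (x : α) : (M.closure {x}).ncard ≤ 4 := by
  have hF : M.closure {x} ⊆ M.E := M.closure_subset_ground _
  have hr : (M.eRk (M.closure {x})).toNat ≤ 1 :=
    eRk_toNat_le_of_eRk_le M hF (m := 1) (by exact_mod_cast eRk_le_one_of_subset_closure_singleton M (subset_refl _))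
  have := ncard_le_eRk_toNat_add_three M hK hd hn hF (by omega)
  omega

/-- A set of rank `≤ 1` containing the non-loop `x` lies in `cl {x}`. -/
theorem subset_closure_singleton_of_eRk_le_one (M : Matroid α) [M.Finite] (hL : ∀ e ∈ M.E, ¬ M.IsLoop e)
    {X : Set α} (hX : X ⊆ M.E) (hr : M.eRk X ≤ 1) {x : α} (hx : x ∈ X) : X ⊆ M.closure {x} := by
  intro y hy
  have hxE : x ∈ M.E := hX hx
  by_cases hyx : y = x
  · subst hyx; exact M.mem_closure_self y hxE
  · have hpair : ({x, y} : Set α) ⊆ X := by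
      intro w hw; rcases hw with rfl | rfl
      · exact hx
      · exact hy
    have hdep : M.Dep {x, y} := by
      have hfin : ({x, y} : Set α).Finite := (Set.finite_singleton x).insert y |>.subset (by
        intro w hw; rcases hw with rfl | rfl <;> simp)
      rw [← Matroid.eRk_lt_encard_iff_dep_of_finite hfin (hpair.trans hX)]
      rw [Set.encard_pair (Ne.symm hyx)]
      calc M.eRk {x, y} ≤ M.eRk X := M.eRk_mono hpair
        _ ≤ 1 := hr
        _ < 2 := by norm_num
    exact mem_closure_singleton_of_dep_pair M hxE (hL x hxE) hdep

/-- Two distinct sets of the same finite size have a union of size at least one more. -/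
theorem ncard_union_ge_succ_of_ne {X X' : Set α} (hX : X.Finite) (hX' : X'.Finite) (hne : X ≠ X')
    (hcard : X'.ncard = X.ncard) : X.ncard + 1 ≤ (X ∪ X').ncard := by
  have hnot : ¬ X' ⊆ X := fun h => hne (Set.eq_of_subset_of_ncard_le h hcard.symm.le hX).symm
  obtain ⟨y, hyX', hyX⟩ := Set.not_subset.1 hnot
  have h1 : insert y X ⊆ X ∪ X' := Set.insert_subset (Or.inr hyX') Set.subset_union_left
  have h2 : (insert y X).ncard = X.ncard + 1 := Set.ncard_insert_of_notMem hyX hX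
  rw [← h2]
  exact Set.ncard_le_ncard h1 (hX.union hX')

/-- **`Q₄¹ ≤ 1`**: at most one `4`-set of rank `≤ 1`. -/
theorem ncard_four_eRk_le_one_le_one (M : Matroid α) [M.Finite] (hL : ∀ e ∈ M.E, ¬ M.IsLoop e)
    (hK : ∀ e, ¬ M.IsColoop e) (hd : M.E.encard = M.eRank + ((4 : ℕ) : ℕ∞)) (hn : M.E.ncard = 12) :
    {X : Set α | X ⊆ M.E ∧ X.ncard = 4 ∧ M.eRk X ≤ 1}.ncard ≤ 1 := by
  have hEfin := M.ground_finite
  rw [Set.ncard_le_one_iff (hEfin.finite_subsets.subset (fun X hX => hX.1))]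
  intro X X' hX hX'
  obtain ⟨hXE, hX4, hXr⟩ := hX
  obtain ⟨hX'E, hX'4, hX'r⟩ := hX'
  by_contra hne
  have hXfin : X.Finite := hEfin.subset hXE
  have hX'fin : X'.Finite := hEfin.subset hX'E
  have h5 : 5 ≤ (X ∪ X').ncard := by
    have := ncard_union_ge_succ_of_ne hXfin hX'fin hne (by omega)
    omega
  have hU : X ∪ X' ⊆ M.E := union_subset hXE hX'E
  rcases (X ∩ X').eq_empty_or_nonempty with hemp | ⟨x, hxX, hxX'⟩
  · -- disjoint: 8 points of rank ≤ 2
    have hcard : (X ∪ X').ncard = 8 := by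
      rw [Set.ncard_union_eq (Set.disjoint_iff_inter_eq_empty.2 hemp) hXfin hX'fin]; omega
    have hr : M.eRk (X ∪ X') ≤ 2 := by
      calc M.eRk (X ∪ X') ≤ M.eRk X + M.eRk X' := M.eRk_union_le_eRk_add_eRk X X'
        _ ≤ 1 + 1 := add_le_add hXr hX'r
        _ = 2 := by norm_num
    have hr' := eRk_toNat_le_of_eRk_le M hU (m := 2) (by exact_mod_cast hr)
    have := ncard_le_eRk_toNat_add_three M hK hd hn hU (by omega)
    omega
  · -- they share `x`: both lie in `cl {x}`
    have h1 := subset_closure_singleton_of_eRk_le_one M hL hXE hXr hxX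
    have h2 := subset_closure_singleton_of_eRk_le_one M hL hX'E hX'r hxX'
    have hr : M.eRk (X ∪ X') ≤ 1 := eRk_le_one_of_subset_closure_singleton M (union_subset h1 h2)
    have hr' := eRk_toNat_le_of_eRk_le M hU (m := 1) (by exact_mod_cast hr)
    have := ncard_le_eRk_toNat_add_three M hK hd hn hU (by omega)
    omega

/-- **`Q₃¹ ≤ 4`**: the `3`-sets of rank `≤ 1` number at most `4`. -/
theorem ncard_three_eRk_le_one_le_four (M : Matroid α) [M.Finite] (hL : ∀ e ∈ M.E, ¬ M.IsLoop e)
    (hK : ∀ e, ¬ M.IsColoop e) (hd : M.E.encard = M.eRank + ((4 : ℕ) : ℕ∞)) (hn : M.E.ncard = 12) :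
    {X : Set α | X ⊆ M.E ∧ X.ncard = 3 ∧ M.eRk X ≤ 1}.ncard ≤ 4 := by
  have hEfin := M.ground_finite
  set 𝒬 := {X : Set α | X ⊆ M.E ∧ X.ncard = 3 ∧ M.eRk X ≤ 1} with h𝒬
  rcases 𝒬.eq_empty_or_nonempty with hemp | ⟨X₀, hX₀⟩
  · rw [hemp]; simp
  obtain ⟨hX₀E, hX₀3, hX₀r⟩ := hX₀
  have hX₀fin : X₀.Finite := hEfin.subset hX₀E
  obtain ⟨x, hxX₀⟩ : X₀.Nonempty := by rw [← Set.ncard_pos hX₀fin, hX₀3]; norm_num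
  have hxE : x ∈ M.E := hX₀E hxX₀
  set F := M.closure {x} with hFdef
  have hF : F ⊆ M.E := M.closure_subset_ground _
  have hFfin : F.Finite := hEfin.subset hF
  have hF4 : F.ncard ≤ 4 := ncard_closure_singleton_le_four M hK hd hn x
  have hX₀F : X₀ ⊆ F := subset_closure_singleton_of_eRk_le_one M hL hX₀E hX₀r hxX₀
  have hsub : 𝒬 ⊆ {X : Set α | X ⊆ F ∧ X.ncard = 3} := by
    intro X hX
    obtain ⟨hXE, hX3, hXr⟩ := hX
    refine ⟨?_, hX3⟩
    rcases (X ∩ F).eq_empty_or_nonempty with hemp | ⟨x', hx'X, hx'F⟩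
    · -- `X` and `X₀` are disjoint, 6 points of rank ≤ 2
      exfalso
      have hXfin : X.Finite := hEfin.subset hXE
      have hdisj : Disjoint X₀ X := by
        rw [Set.disjoint_left]
        intro w hw hwX
        have : w ∈ X ∩ F := ⟨hwX, hX₀F hw⟩
        rw [hemp] at this
        exact this
      have hcard : (X₀ ∪ X).ncard = 6 := by
        rw [Set.ncard_union_eq hdisj hX₀fin hXfin]; omega
      have hU : X₀ ∪ X ⊆ M.E := union_subset hX₀E hXE
      have hr : M.eRk (X₀ ∪ X) ≤ 2 := by
        calc M.eRk (X₀ ∪ X) ≤ M.eRk X₀ + M.eRk X := M.eRk_union_le_eRk_add_eRk X₀ X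
          _ ≤ 1 + 1 := add_le_add hX₀r hXr
          _ = 2 := by norm_num
      have hr' := eRk_toNat_le_of_eRk_le M hU (m := 2) (by exact_mod_cast hr)
      have := ncard_le_eRk_toNat_add_three M hK hd hn hU (by omega)
      omega
    · have hx'E : x' ∈ M.E := hXE hx'X
      have h1 : X ⊆ M.closure {x'} := subset_closure_singleton_of_eRk_le_one M hL hXE hXr hx'X
      have h2 : M.closure {x'} = F :=
        closure_singleton_eq_of_mem_closure_singleton M hxE (hL x hxE) hx'F (hL x' hx'E)
      rw [← h2]; exact h1
  calc 𝒬.ncard ≤ {X : Set α | X ⊆ F ∧ X.ncard = 3}.ncard :=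
        Set.ncard_le_ncard hsub (hFfin.finite_subsets.subset (fun X hX => hX.1))
    _ = F.ncard.choose 3 := ncard_subsets_eq_choose hFfin 3
    _ ≤ (4 : ℕ).choose 3 := Nat.choose_le_choose 3 hF4
    _ = 4 := by decide

/-- A proper subset of a `2`-set of non-loops is independent. -/
theorem indep_of_ssubset_pair (M : Matroid α) [M.Finite] (hL : ∀ e ∈ M.E, ¬ M.IsLoop e) {P Q : Set α}
    (hP : P ⊆ M.E) (hP2 : P.ncard = 2) (hQ : Q ⊂ P) : M.Indep Q := by
  have hPfin : P.Finite := M.ground_finite.subset hP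
  have hQ1 : Q.ncard ≤ 1 := by
    have := Set.ncard_lt_ncard hQ hPfin
    omega
  rw [Set.ncard_le_one_iff_eq (hPfin.subset hQ.subset)] at hQ1
  rcases hQ1 with rfl | ⟨w, rfl⟩
  · exact M.empty_indep
  · have hw : w ∈ M.E := hP (hQ.subset (Set.mem_singleton w))
    exact indep_singleton_of_not_isLoop M hw (hL w hw)

/-- A dependent pair meeting the class `cl {x}` of a non-loop `x` lies inside it. -/
theorem subset_closure_singleton_of_dep_pair_mem (M : Matroid α) (hL : ∀ e ∈ M.E, ¬ M.IsLoop e) {x : α}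
    (hxE : x ∈ M.E) {P : Set α} (hPE : P ⊆ M.E) (hP2 : P.ncard = 2) (hPdep : M.Dep P) {u : α} (huP : u ∈ P)
    (huF : u ∈ M.closure {x}) : P ⊆ M.closure {x} := by
  intro v hvP
  have huE : u ∈ M.E := hPE huP
  by_cases hvu : v = u
  · subst hvu; exact huF
  · have hPuv : P = {u, v} := by
      obtain ⟨a, b, hab, rfl⟩ := Set.ncard_eq_two.1 hP2
      rcases huP with rfl | rfl
      · rcases hvP with rfl | rfl
        · exact absurd rfl hvu
        · rfl
      · rcases hvP with rfl | rfl
        · exact Set.pair_comm _ _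
        · exact absurd rfl hvu
    have hvcl : v ∈ M.closure {u} := by
      rw [hPuv] at hPdep
      exact mem_closure_singleton_of_dep_pair M huE (hL u huE) hPdep
    have hcl : M.closure {u} = M.closure {x} :=
      closure_singleton_eq_of_mem_closure_singleton M hxE (hL x hxE) huF (hL u huE)
    rw [← hcl]; exact hvcl

/-- **The dependent pairs outside the class of a dependent pair**: with `F = cl {x}` for a dependent pair `{x, y}`, the
dependent pairs not inside `F` number at most `C(5 − |F|, 2)` — they live in the set `U'` of points outside `F` having a
partner, whose nullity is `≤ 4 − |F|` (`F ∪ U'` is proper, as `E` is not covered by parallel pairs). -/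
theorem ncard_dep_pairs_not_subset_closure_le (M : Matroid α) [M.Finite] (hL : ∀ e ∈ M.E, ¬ M.IsLoop e)
    (hK : ∀ e, ¬ M.IsColoop e) (hd : M.E.encard = M.eRank + ((4 : ℕ) : ℕ∞)) (hn : M.E.ncard = 12)
    {x y : α} (hxy : x ≠ y) (hxE : x ∈ M.E) (hyE : y ∈ M.E) (hdep : M.Dep {x, y}) :
    {P : Set α | P ⊆ M.E ∧ P.ncard = 2 ∧ M.Dep P ∧ ¬ P ⊆ M.closure {x}}.ncard ≤
      (5 - (M.closure {x}).ncard).choose 2 := by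
  classical
  have hEfin := M.ground_finite
  have hLx := hL x hxE
  set F := M.closure {x} with hFdef
  have hF : F ⊆ M.E := M.closure_subset_ground _
  have hFfin : F.Finite := hEfin.subset hF
  have hF4 : F.ncard ≤ 4 := ncard_closure_singleton_le_four M hK hd hn x
  have hxF : x ∈ F := M.mem_closure_self x hxE
  -- the points outside `F` with a partner
  set U' := {u ∈ M.E | u ∉ F ∧ ∃ v ∈ M.E, v ≠ u ∧ M.Dep {u, v}} with hU'def
  have hU'E : U' ⊆ M.E := fun u hu => hu.1
  have hU'fin : U'.Finite := hEfin.subset hU'E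
  have hdisj : Disjoint F U' := by
    rw [Set.disjoint_left]
    intro u huF huU'
    exact huU'.2.1 huF
  -- `F ∪ U' ≠ E`: otherwise every point has a partner and `2 · 8 ≤ 12`
  have hV : F ∪ U' ≠ M.E := by
    intro hV
    have hpart : ∀ u ∈ M.E, ∃ v ∈ M.E, v ≠ u ∧ M.Dep {u, v} := by
      intro u huE
      have : u ∈ F ∪ U' := by rw [hV]; exact huE
      rcases this with huF | huU'
      · by_cases hux : u = x
        · subst hux
          exact ⟨y, hyE, Ne.symm hxy, hdep⟩
        · refine ⟨x, hxE, Ne.symm hux, ?_⟩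
          have hI : M.Indep {x} := indep_singleton_of_not_isLoop M hxE hLx
          have : M.Dep (insert u {x}) := by
            rw [hI.insert_dep_iff]
            exact ⟨huF, fun h => hux (Set.mem_singleton_iff.1 h)⟩
          exact this
      · exact huU'.2.2
    have := two_mul_eRk_toNat_le_ncard_of_partner M hL M.E.ncard M.E (subset_refl _) rfl hpart
    rw [eRk_ground_toNat_eq_eight M hd hn] at this
    omega
  have hVE : F ∪ U' ⊆ M.E := union_subset hF hU'E
  have hVnull := ncard_add_one_le_eRk_toNat_add_of_ssubset M hd hK hVE hV
  have hVcard : (F ∪ U').ncard = F.ncard + U'.ncard := Set.ncard_union_eq hdisj hFfin hU'fin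
  have hVrk : (M.eRk (F ∪ U')).toNat ≤ 1 + (M.eRk U').toNat := by
    have h : M.eRk (F ∪ U') ≤ 1 + M.eRk U' := by
      calc M.eRk (F ∪ U') ≤ M.eRk F + M.eRk U' := M.eRk_union_le_eRk_add_eRk F U'
        _ ≤ 1 + M.eRk U' := by
          gcongr
          exact eRk_le_one_of_subset_closure_singleton M (subset_refl _)
    rw [← S1.coe_toNat_eRk M hVE, ← S1.coe_toNat_eRk M hU'E] at h
    exact_mod_cast h
  -- nullity of `U'` is `≤ 4 − |F|`
  have hU'null : U'.ncard ≤ (M.eRk U').toNat + (4 - F.ncard) := by omega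
  -- the pairs outside `F` are relative circuits of `U'`
  have hout : {P : Set α | P ⊆ M.E ∧ P.ncard = 2 ∧ M.Dep P ∧ ¬ P ⊆ F} ⊆
      {P : Set α | P ⊆ U' ∧ P.ncard = 2 ∧ M.Dep (∅ ∪ P) ∧ ∀ Q, Q ⊂ P → M.Indep (∅ ∪ Q)} := by
    intro P hP
    obtain ⟨hPE, hP2, hPdep, hPF⟩ := hP
    refine ⟨?_, hP2, by simpa using hPdep, fun Q hQ => by simpa using indep_of_ssubset_pair M hL hPE hP2 hQ⟩
    intro u huP
    refine ⟨hPE huP, fun huF => hPF (subset_closure_singleton_of_dep_pair_mem M hL hxE hPE hP2 hPdep huP huF), ?_⟩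
    obtain ⟨a, b, hab, rfl⟩ := Set.ncard_eq_two.1 hP2
    rcases huP with rfl | rfl
    · exact ⟨b, hPE (by simp), Ne.symm hab, hPdep⟩
    · exact ⟨a, hPE (by simp), hab, by rwa [Set.pair_comm]⟩
  have h5 : 4 - F.ncard + 2 - 1 = 5 - F.ncard := by omega
  rw [← h5]
  refine (Set.ncard_le_ncard hout (relCircuits_finite M ∅ hU'E 2)).trans ?_
  apply ncard_relCircuits_le M 2 (by norm_num) (4 - F.ncard) ∅ U' (empty_subset _) hU'E
    (Set.disjoint_left.2 fun a ha => absurd ha (Set.notMem_empty a)) M.empty_indep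
  simpa using hU'null

/-- **`D₂ ≤ 6`**: the dependent pairs number at most `6`. -/
theorem ncard_dep_pairs_le_six (M : Matroid α) [M.Finite] (hL : ∀ e ∈ M.E, ¬ M.IsLoop e)
    (hK : ∀ e, ¬ M.IsColoop e) (hd : M.E.encard = M.eRank + ((4 : ℕ) : ℕ∞)) (hn : M.E.ncard = 12) :
    {P : Set α | P ⊆ M.E ∧ P.ncard = 2 ∧ M.Dep P}.ncard ≤ 6 := by
  classical
  have hEfin := M.ground_finite
  set 𝒟 := {P : Set α | P ⊆ M.E ∧ P.ncard = 2 ∧ M.Dep P} with h𝒟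
  have h𝒟fin : 𝒟.Finite := hEfin.finite_subsets.subset (fun P hP => hP.1)
  rcases 𝒟.eq_empty_or_nonempty with hemp | ⟨P₀, hP₀⟩
  · rw [hemp]; simp
  obtain ⟨hP₀E, hP₀2, hP₀dep⟩ := hP₀
  obtain ⟨x, y, hxy, rfl⟩ := Set.ncard_eq_two.1 hP₀2
  have hxE : x ∈ M.E := hP₀E (by simp)
  have hyE : y ∈ M.E := hP₀E (by simp)
  have hLx := hL x hxE
  set F := M.closure {x} with hFdef
  have hF : F ⊆ M.E := M.closure_subset_ground _
  have hFfin : F.Finite := hEfin.subset hF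
  have hF4 : F.ncard ≤ 4 := ncard_closure_singleton_le_four M hK hd hn x
  have hxF : x ∈ F := M.mem_closure_self x hxE
  have hyF : y ∈ F := mem_closure_singleton_of_dep_pair M hxE hLx hP₀dep
  have hF2 : 2 ≤ F.ncard := by
    have : ({x, y} : Set α) ⊆ F := by
      intro w hw; rcases hw with rfl | rfl
      · exact hxF
      · exact hyF
    rw [← Set.ncard_pair hxy]
    exact Set.ncard_le_ncard this hFfin
  have hcount_out := ncard_dep_pairs_not_subset_closure_le M hL hK hd hn hxy hxE hyE hP₀dep
  have hcount_in : {P ∈ 𝒟 | P ⊆ F}.ncard ≤ F.ncard.choose 2 := by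
    have hsub : {P ∈ 𝒟 | P ⊆ F} ⊆ {X : Set α | X ⊆ F ∧ X.ncard = 2} := fun P hP => ⟨hP.2, hP.1.2.1⟩
    rw [← ncard_subsets_eq_choose hFfin 2]
    exact Set.ncard_le_ncard hsub (hFfin.finite_subsets.subset (fun X hX => hX.1))
  have hsplit : 𝒟 ⊆ {P ∈ 𝒟 | P ⊆ F} ∪ {P : Set α | P ⊆ M.E ∧ P.ncard = 2 ∧ M.Dep P ∧ ¬ P ⊆ F} := by
    intro P hP
    by_cases h : P ⊆ F
    · exact Or.inl ⟨hP, h⟩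
    · exact Or.inr ⟨hP.1, hP.2.1, hP.2.2, h⟩
  have htot : 𝒟.ncard ≤ F.ncard.choose 2 + (5 - F.ncard).choose 2 := by
    calc 𝒟.ncard ≤ ({P ∈ 𝒟 | P ⊆ F} ∪
          {P : Set α | P ⊆ M.E ∧ P.ncard = 2 ∧ M.Dep P ∧ ¬ P ⊆ F}).ncard :=
          Set.ncard_le_ncard hsplit ((h𝒟fin.subset (fun P hP => hP.1)).union
            (hEfin.finite_subsets.subset (fun P hP => hP.1)))
      _ ≤ {P ∈ 𝒟 | P ⊆ F}.ncard +
          {P : Set α | P ⊆ M.E ∧ P.ncard = 2 ∧ M.Dep P ∧ ¬ P ⊆ F}.ncard := Set.ncard_union_le _ _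
      _ ≤ F.ncard.choose 2 + (5 - F.ncard).choose 2 := add_le_add hcount_in hcount_out
  have hbound : ∀ f : ℕ, 2 ≤ f → f ≤ 4 → f.choose 2 + (5 - f).choose 2 ≤ 6 := by
    intro f h2 h4
    interval_cases f <;> decide
  exact htot.trans (hbound F.ncard hF2 hF4)

end S1CF

end PercRepro
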